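import Summits.QuantumFields.BalabanUV.Beta.SymCorrectorKernel
import Summits.QuantumFields.BalabanUV.Beta.GAN24.SecondOrderReadersParity

/-!
# `BalabanUV.Beta.GAN24.CombTransportParity` — binder row G-an2-4 ∕ (CONV-C), TRANSFER-III (the G-an2-4 END at row D1's literal of record (III′)), THE LEG CONGRUENCE
# `𝒯′ X := Ψ̂_Sᵀ ∘ X ∘ Ψ̂_S` OF road-P2's M.43 ∕ M.45 COMMUTES WITH THE ROW-PARITY INVOLUTION `P := sgnK ∘ trK`:
# **`Ψ̂_S` is sign-symmetric (`sgnK Ψ̂_S = Ψ̂_S`: field block kept, multiplier block kept, mixed blocks zero), hence `P (Ψ̂ᵀ∘X∘Ψ̂) = Ψ̂ᵀ∘(P X)∘Ψ̂` for every localised `X`;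
# parity-odd tables stay parity-odd and parity-even stay parity-even under `𝒯′`, and the even ∕ odd halves are transported to the even ∕ odd halves** — the kernel-leg
# companion of leaf-01 g79's `GAN24/SlotTransportParity` (the slot leg `slotPsiS` commutes with `P`); together: the full transport `𝒯 = 𝒯′ ∘ slotPsiS` of M.43 maps the even
# tower to the even tower (G-an2-4 CRUX TEAM (2), seat `b2b-balaban-gan24-p2` = road-P2 chair, gen 55)

NOT IN PRINT; OUR BOOKKEEPING ([folklore] kernel bookkeeping BY NAME over an2's `BorderedHessianSymmetry.{sgnK, comp_sgnK, trK_sgnK, sgnK_sgnK}`, an5's `TameKernelCalculus`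
(`trK_comp`, `comp_assoc_tame`, `comp_add ∕ sub_*_tame`), d1-formalise-leaf-03's `SymCorrectorKernel.psiKS_*`, leaf-03's `SecondOrderReadersParity.parityOdd_iff ∕ parityEven_iff`; 0 `def`,
0 cited fact, 0 `def … : Prop`, 0 sorry).
HONEST FRAMING (cell contract, verbatim): «discharging `BetaPertH` makes Bałaban's UV stability UNCONDITIONAL — a real constructive-QFT result; it is NOT the continuum
limit and NOT the Clay problem.»  HONEST DEPENDENCY (verbatim): «continuum YM on T⁴ ⇐ BetaPertH ∧ nine spine estimates (0/9 proved); BetaPertH ⇐ (D1) ∧ (D4) ∧ CAP+tail;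
G-an2-4 gates asym, D1 and NE2/3/4.»
ABSOLUTE RULE (cell charter, verbatim): «No internally-minted statement may enter as a cited fact. Every hypothesis is either kernel-proved in this package or a
verbatim quotation of a PUBLISHED theorem with page reference. The manuscript(s) under audit are NOT citable for their own disputed steps — they are the thing under
adjudication; programme-internal (2001/route/tribunal) claims are never citable.»  Nothing is cited here.

## What is proved (generic `d`; any block side `n`, any root offset `r`; `Ψ̂ = psiKS r n`; `Spr Ψ̂` displayed where association is needed — `spr_psiKS` at `0 < n`, `r ∈ box`)
* §1 `sgnK_psiKS` (`sgnK Ψ̂ = Ψ̂`), `sgnK_trK_psiKS` (`sgnK Ψ̂ᵀ = Ψ̂ᵀ`).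
* §2 **`parity_conj_psiKS`**: `Loc X ⟹ sgnK (trK (Ψ̂ᵀ∘X∘Ψ̂)) = Ψ̂ᵀ ∘ sgnK (trK X) ∘ Ψ̂`; **`parityOdd_conj_psiKS`** ∕ **`parityEven_conj_psiKS`** (the parity letters survive `𝒯′`);
  **`conj_psiKS_evenHalf ∕ conj_psiKS_oddHalf`**: `𝒯′ (½•(X ± P X)) = ½•(𝒯′X ± P (𝒯′X))`.
WHAT THIS IS NOT: the slot leg (leaf-01's `SlotTransportParity`, not restated); NO value, NO rate, NO row; NO campaign opened (an2 W-4 stands); NEVER «G-an2-4 closed» as (CONV-C); NOT D1,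
NOT `BetaPertH`, NOT continuum, NOT Clay.  2026-08-25; no existing file touched.
-/

noncomputable section

open Literature.MathematicalPhysics.QuantumFieldTheory
open Literature.MathematicalPhysics.QuantumFieldTheory.Balaban1983to89
open Literature.MathematicalPhysics.QuantumFieldTheory.Balaban1983to89.Beta
open ExpKernelCalculus (MKer comp)
open AffineAveraging (box)
open OneStepResolventKernel (Fib)
open Summit.QuantumFields.BalabanUV.Beta.TameKernelCalculus
open Summit.QuantumFields.BalabanUV.Beta.BorderedHessian (sgnK sgnK_eq_self comp_sgnK trK_sgnK sgnK_sgnK)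
open Summit.QuantumFields.BalabanUV.Beta.SymCorrectorKernel (psiKS psiKS_inl_inr psiKS_inr_inl spr_psiKS)
open Summit.QuantumFields.BalabanUV.Beta.GAN24.SecondOrderReadersParity (parityOdd_iff parityEven_iff)

namespace Summit.QuantumFields.BalabanUV.Beta.GAN24.CombTransportParity

variable {d : ℕ} (r : Fin (d + 1) → ℕ) (n : ℕ)

/-! ## §1 The corrector is sign-symmetric -/

/-- [folklore] **`sgnK Ψ̂_S = Ψ̂_S`**: the field–field block carries `(+1)(+1)`, the multiplier–multiplier block `(−1)(−1)`, the mixed blocks are zero. -/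
theorem sgnK_psiKS : sgnK (psiKS r n) = psiKS r n :=
  -- an2's `BorderedHessian.sgnK_eq_self` (a kernel with vanishing mixed blocks is `sgnK`-fixed) BY NAME
  -- (leaf-05 g85 X-CTPAR NIT-1): the mixed blocks of `Ψ̂_S` vanish by `psiKS_inl_inr` ∕ `psiKS_inr_inl`.
  sgnK_eq_self (fun x y α μ => psiKS_inl_inr r n x y α μ) (fun x y μ α => psiKS_inr_inl r n x y μ α)

/-- [folklore] `sgnK Ψ̂_Sᵀ = Ψ̂_Sᵀ`. -/
theorem sgnK_trK_psiKS : sgnK (trK (psiKS r n)) = trK (psiKS r n) := by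
  rw [← trK_sgnK, sgnK_psiKS]

/-! ## §2 The leg congruence commutes with the parity involution -/

variable {r n}

/-- NOT IN PRINT; OUR BOOKKEEPING ([folklore]).  **`P (Ψ̂ᵀ ∘ X ∘ Ψ̂) = Ψ̂ᵀ ∘ (P X) ∘ Ψ̂`** for `P = sgnK ∘ trK`, a spread `Ψ̂` (displayed) and a localised `X`
(`trK_comp` twice, `comp_sgnK` twice, §1, one tame re-association). -/
theorem parity_conj_psiKS (hΨ : Spr (psiKS r n)) {X : MKer (d + 1) (Fib d)} (hX : Loc X) :
    sgnK (trK (comp (comp (trK (psiKS r n)) X) (psiKS r n))) = comp (comp (trK (psiKS r n)) (sgnK (trK X))) (psiKS r n) := by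
  rw [trK_comp, trK_comp, trK_trK, ← comp_sgnK, ← comp_sgnK, sgnK_psiKS, sgnK_trK_psiKS]
  have hPX : Loc (sgnK (trK X)) := SpineRecursiveParity.loc_sgnK hX.trK
  exact comp_assoc_tame hΨ.trK.tame hPX.tame hΨ.tame

/-- NOT IN PRINT; OUR BOOKKEEPING ([folklore]).  **A PARITY-ODD LOCALISED TABLE STAYS PARITY-ODD UNDER `𝒯′`**: `trK X = −sgnK X ⟹ trK (Ψ̂ᵀXΨ̂) = −sgnK (Ψ̂ᵀXΨ̂)`. -/
theorem parityOdd_conj_psiKS (hΨ : Spr (psiKS r n)) {X : MKer (d + 1) (Fib d)} (hX : Loc X) (hXt : trK X = -sgnK X) :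
    trK (comp (comp (trK (psiKS r n)) X) (psiKS r n)) = -sgnK (comp (comp (trK (psiKS r n)) X) (psiKS r n)) := by
  rw [parityOdd_iff] at hXt ⊢
  rw [parity_conj_psiKS hΨ hX, hXt, comp_neg_right, comp_neg_left]

/-- NOT IN PRINT; OUR BOOKKEEPING ([folklore]).  **A PARITY-EVEN LOCALISED TABLE STAYS PARITY-EVEN UNDER `𝒯′`.** -/
theorem parityEven_conj_psiKS (hΨ : Spr (psiKS r n)) {X : MKer (d + 1) (Fib d)} (hX : Loc X) (hXt : trK X = sgnK X) :
    trK (comp (comp (trK (psiKS r n)) X) (psiKS r n)) = sgnK (comp (comp (trK (psiKS r n)) X) (psiKS r n)) := by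
  rw [parityEven_iff] at hXt ⊢
  rw [parity_conj_psiKS hΨ hX, hXt]

/-- NOT IN PRINT; OUR BOOKKEEPING ([folklore]).  **`𝒯′` MAPS THE EVEN HALF TO THE EVEN HALF**: `Ψ̂ᵀ ∘ (½•(X + P X)) ∘ Ψ̂ = ½•(𝒯′X + P (𝒯′X))` for localised `X`. -/
theorem conj_psiKS_evenHalf (hΨ : Spr (psiKS r n)) {X : MKer (d + 1) (Fib d)} (hX : Loc X) :
    comp (comp (trK (psiKS r n)) ((1 / 2 : ℝ) • (X + sgnK (trK X)))) (psiKS r n)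
      = (1 / 2 : ℝ) • (comp (comp (trK (psiKS r n)) X) (psiKS r n) + sgnK (trK (comp (comp (trK (psiKS r n)) X) (psiKS r n)))) := by
  have hPX : Loc (sgnK (trK X)) := SpineRecursiveParity.loc_sgnK hX.trK
  rw [parity_conj_psiKS hΨ hX, KernelReflection.comp_smul_right, KernelReflection.comp_smul_left,
    comp_add_right_tame hΨ.trK.tame hX.tame hPX.tame, comp_add_left_tame (hΨ.trK.comp_loc hX).tame (hΨ.trK.comp_loc hPX).tame hΨ.tame]

/-- NOT IN PRINT; OUR BOOKKEEPING ([folklore]).  **`𝒯′` MAPS THE ODD HALF TO THE ODD HALF**: `Ψ̂ᵀ ∘ (½•(X − P X)) ∘ Ψ̂ = ½•(𝒯′X − P (𝒯′X))` for localised `X`. -/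
theorem conj_psiKS_oddHalf (hΨ : Spr (psiKS r n)) {X : MKer (d + 1) (Fib d)} (hX : Loc X) :
    comp (comp (trK (psiKS r n)) ((1 / 2 : ℝ) • (X - sgnK (trK X)))) (psiKS r n)
      = (1 / 2 : ℝ) • (comp (comp (trK (psiKS r n)) X) (psiKS r n) - sgnK (trK (comp (comp (trK (psiKS r n)) X) (psiKS r n)))) := by
  have hPX : Loc (sgnK (trK X)) := SpineRecursiveParity.loc_sgnK hX.trK
  rw [parity_conj_psiKS hΨ hX, KernelReflection.comp_smul_right, KernelReflection.comp_smul_left,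
    comp_sub_right_tame hΨ.trK.tame hX.tame hPX.tame, comp_sub_left_tame (hΨ.trK.comp_loc hX).tame (hΨ.trK.comp_loc hPX).tame hΨ.tame]

/-- NOT IN PRINT; OUR BOOKKEEPING ([folklore]; AT THE CHART OF RECORD).  The same four facts with `Spr Ψ̂_S` DISCHARGED (`0 < n`, `r ∈ box (d+1) n`, leaf-03's `spr_psiKS`):
the leg congruence of road-P2's `CombCubicStepTransport` ∕ `CombQuarticStepTransport` commutes with `P` on every localised table. -/
theorem parity_conj_psiKS_of_box (hn : 0 < n) (hr : r ∈ box (d + 1) n) {X : MKer (d + 1) (Fib d)} (hX : Loc X) :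
    sgnK (trK (comp (comp (trK (psiKS r n)) X) (psiKS r n))) = comp (comp (trK (psiKS r n)) (sgnK (trK X))) (psiKS r n) :=
  parity_conj_psiKS (spr_psiKS hn hr) hX

end Summit.QuantumFields.BalabanUV.Beta.GAN24.CombTransportParity

end
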